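import Summits.ValiantsHypothesis.ValiantsHypothesis.Theorems.KPlusLogSqLawTropicalPermutationChanges
import Summits.ValiantsHypothesis.ValiantsHypothesis.Theorems.KPlusLogSqLawTropicalBScaleSeparation

/-!
# Route `KPlusLogSqLaw`, crux `TropicalB` — the DISPLACEMENT BOUND: alternations are paid for by moved columns

HONEST FRAMING.  Support file toward the registered stubs `stub_tropThin` / `stub_tropFat` of the crux `TropicalB`
(ledger item `stmt-ValiantsHypothesis-19771`, route `KPlusLogSqLaw`; cell `pub-symmetroid`, seat val-sym-trop-p4, 2026-08-26).
A structural inequality for dominant sign-alternating chains of an ARBITRARY dominance design (no sector, no assumption on the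
exponents); it proves NEITHER stub and asserts nothing about `TropicalB` inside its window, `Lifting`, `KPlusLogSqLaw`,
`MatrixDescartes` or `VP ≠ VNP`.  It is the quantitative «version 0» of the carry-cost question of the cell's `K = 4` fork
(desk R1355 (b)/(i)): RESET MASS ≤ DISPLACEMENT.

THE BOUND.  Let `p₀, …, pₙ` (`pₖ = (σₖ, λₖ)`) be dominant at strictly increasing slopes with alternating signs (hypothesis list
of `TropRootLawAt`).  Call column `i` MOVED at step `k` if `σₖ i ≠ σₖ₊₁ i`, and let the DISPLACEMENT be
`D = Σₖ #{i : σₖ i ≠ σₖ₊₁ i}` (the total length, in columns, of all permutation changes).  Then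

  `steps_le_pred_mul_add_displacement :  n ≤ (K − 1) · (m + D)`.

Ingredients: (1) every step raises the exponent of SOME column (the total exponent strictly increases, `sum_d_lt_of_dominant`);
(2) a column whose exponent DROPS at a step is moved at that step (cross-permutation entry monotonicity,
`dRank_le_of_chain_entry` of `…TropicalPermutationChanges`) — `card_classDown_le_card_moved`; (3) for each column the
exponent rank lives in `[0, K−1]`, so its number of rises is at most `(K−1)·(number of drops + 1)` (`card_ups_le`, a telescoping
count).  Compare the switch budget `n ≤ m²(K−1) + #{permutation-changing steps}` (`le_permChanges_add`): here each
permutation change is weighed by its LENGTH, and the additive term is `m(K−1)` instead of `m²(K−1)`.  Reading: a chain with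
many deep resets of its low digits (the odometer of `…TropicalBScaleSeparation` / `…LexStrict`) must move proportionally many
columns — in SHIFT-THREE the `m − 1` carries are `m`-cycles (displacement `≈ m²` for `≈ m²/2` alternations); a cubic `K = 4`
family needs displacement `Ω(m³)`, i.e. permutation changes of average length `Ω(m³ / #changes)`.

[folklore] (exchange argument + telescoping).
-/

-- `Summit.ValiantsHypothesis.ValiantsHypothesis.…` repeats a component by the D-0017 layout
-- (single-conjunct summit), which the `dupNamespace` linter flags; the name is mandated.
set_option linter.dupNamespace false
set_option autoImplicit false

namespace Summit.ValiantsHypothesis.ValiantsHypothesis.Theorems.LacunarySymmetroidMatrixDescartes.TropicalCensus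

open Summit.ValiantsHypothesis.ValiantsHypothesis.Theorems.MatrixDescartes.Negative
open Finset

section Displacement

variable {m K : ℕ}

/-! ## 1. A telescoping count for bounded sequences -/

/-- For a sequence `x₀, …, xₙ` with values in `[0, B]`, the number of strict rises is at most `B · (number of strict drops + 1)`:
the total rise equals `xₙ − x₀ +` the total drop, each rise is `≥ 1`, each drop is `≤ B`. [folklore] -/
theorem card_ups_le {n : ℕ} (x : Fin (n + 1) → ℕ) (B : ℕ) (hx : ∀ k, x k ≤ B) :
    (univ.filter fun k : Fin n => x k.castSucc < x k.succ).card ≤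
      B * ((univ.filter fun k : Fin n => x k.succ < x k.castSucc).card + 1) := by
  -- rise and drop amounts
  set inc : Fin n → ℕ := fun k => x k.succ - x k.castSucc with hinc
  set dec : Fin n → ℕ := fun k => x k.castSucc - x k.succ with hdec
  have hstep : ∀ k : Fin n, x k.succ + dec k = x k.castSucc + inc k := by
    intro k; simp only [hinc, hdec]; omega
  -- telescoping: Σ inc + x 0 = x last + Σ dec
  have htel : ∑ k, inc k + x 0 = x (Fin.last n) + ∑ k, dec k := by
    have h1 : ∑ k : Fin n, x k.succ + ∑ k : Fin n, dec k = ∑ k : Fin n, x k.castSucc + ∑ k : Fin n, inc k := by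
      rw [← sum_add_distrib, ← sum_add_distrib]; exact sum_congr rfl fun k _ => hstep k
    have h2 : ∑ j : Fin (n + 1), x j = x 0 + ∑ k : Fin n, x k.succ := Fin.sum_univ_succ x
    have h3 : ∑ j : Fin (n + 1), x j = ∑ k : Fin n, x k.castSucc + x (Fin.last n) := Fin.sum_univ_castSucc x
    omega
  -- each rise contributes ≥ 1 to Σ inc
  have hups : (univ.filter fun k : Fin n => x k.castSucc < x k.succ).card ≤ ∑ k, inc k := by
    rw [card_eq_sum_ones, ← sum_filter_add_sum_filter_not univ (fun k : Fin n => x k.castSucc < x k.succ) inc]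
    refine le_add_right (sum_le_sum fun k hk => ?_)
    have := (mem_filter.mp hk).2
    simp only [hinc]; omega
  -- each drop contributes ≤ B to Σ dec, non-drops contribute 0
  have hdowns : ∑ k, dec k ≤ B * (univ.filter fun k : Fin n => x k.succ < x k.castSucc).card := by
    rw [← sum_filter_add_sum_filter_not univ (fun k : Fin n => x k.succ < x k.castSucc) dec]
    have h0 : ∑ k ∈ univ.filter (fun k : Fin n => ¬ x k.succ < x k.castSucc), dec k = 0 :=
      sum_eq_zero fun k hk => by have := (mem_filter.mp hk).2; simp only [hdec]; omega
    rw [h0, add_zero, mul_comm, card_eq_sum_ones, sum_mul]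
    refine sum_le_sum fun k _ => ?_
    have := hx k.castSucc
    simp only [hdec]; omega
  have hlast := hx (Fin.last n)
  nlinarith

/-! ## 2. Drops are moves; every step has a rise -/

/-- **Drops are moves** (one step): between the unique optima `p` at `θa` and `q` at `θb > θa`, every column whose exponent
strictly DROPS has changed its row — a column keeping its entry can only keep or raise its class
(`d_lt_of_dominant_entry`).  So a reset of the low digits by `ρ` columns is a permutation change moving `≥ ρ` columns. [folklore] -/
theorem card_classDown_le_card_moved (d : Fin K → ℕ) (v ε : Fin m → Fin m → Fin K → ℤ) {θa θb : ℤ} (hab : θa < θb)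
    (p q : Equiv.Perm (Fin m) × (Fin m → Fin K)) (ha : IsDominant d v ε θa p) (hb : IsDominant d v ε θb q) :
    (univ.filter fun i => d (q.2 i) < d (p.2 i)).card ≤ (univ.filter fun i => p.1 i ≠ q.1 i).card := by
  refine card_le_card fun i hi => ?_
  rw [mem_filter] at hi ⊢
  refine ⟨mem_univ _, fun hrow => ?_⟩
  by_cases hcl : p.2 i = q.2 i
  · rw [hcl] at hi; exact lt_irrefl _ hi.2
  · exact absurd hi.2 (not_lt.mpr (d_lt_of_dominant_entry d v ε hab p.1 q.1 p.2 q.2 ha hb i hrow hcl).le)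

/-- every step of a dominant chain raises the exponent rank of some column (the total exponent strictly increases). -/
theorem exists_dRank_lt_step (d : Fin K → ℕ) (v ε : Fin m → Fin m → Fin K → ℤ) {n : ℕ} (θ : Fin (n + 1) → ℤ)
    (p : Fin (n + 1) → Equiv.Perm (Fin m) × (Fin m → Fin K)) (hθ : StrictMono θ)
    (hdom : ∀ k, IsDominant d v ε (θ k) (p k))
    (halt : ∀ k : Fin n, termSign ε (p k.castSucc) * termSign ε (p k.succ) < 0) (k : Fin n) :
    ∃ i, dRank d ((p k.castSucc).2 i) < dRank d ((p k.succ).2 i) := by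
  have hne : p k.castSucc ≠ p k.succ := by
    intro h
    have := halt k
    rw [h] at this
    exact absurd this (not_lt.mpr (mul_self_nonneg _))
  have hlt := sum_d_lt_of_dominant d v ε (hθ Fin.castSucc_lt_succ) hne (hdom _) (hdom _)
  obtain ⟨i, _, hi⟩ := exists_lt_of_sum_lt hlt
  exact ⟨i, dRank_lt_of_lt d hi⟩

/-! ## 3. The displacement bound -/

/-- per column: the rises of its exponent rank number at most `(K−1)·(moves + 1)`. -/
theorem card_ups_col_le (d : Fin K → ℕ) (v ε : Fin m → Fin m → Fin K → ℤ) {n : ℕ} (θ : Fin (n + 1) → ℤ)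
    (p : Fin (n + 1) → Equiv.Perm (Fin m) × (Fin m → Fin K)) (hθ : StrictMono θ)
    (hdom : ∀ k, IsDominant d v ε (θ k) (p k)) (i : Fin m) :
    (univ.filter fun k : Fin n => dRank d ((p k.castSucc).2 i) < dRank d ((p k.succ).2 i)).card ≤
      (K - 1) * ((univ.filter fun k : Fin n => (p k.castSucc).1 i ≠ (p k.succ).1 i).card + 1) := by
  have h1 := card_ups_le (fun k : Fin (n + 1) => dRank d ((p k).2 i)) (K - 1) (fun k => dRank_le d _)
  -- drops ⊆ moves
  have h2 : (univ.filter fun k : Fin n => dRank d ((p k.succ).2 i) < dRank d ((p k.castSucc).2 i)).card ≤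
      (univ.filter fun k : Fin n => (p k.castSucc).1 i ≠ (p k.succ).1 i).card := by
    refine card_le_card fun k hk => ?_
    rw [mem_filter] at hk ⊢
    refine ⟨mem_univ _, fun hrow => ?_⟩
    exact absurd hk.2 (not_lt.mpr (dRank_le_of_chain_entry d v ε θ p hθ hdom
      (Fin.le_iff_val_le_val.mpr (by simp [Fin.val_succ])) i hrow))
  exact h1.trans (Nat.mul_le_mul_left _ (Nat.add_le_add_right h2 1))

/-- **THE DISPLACEMENT BOUND.**  Along every dominant sign-alternating chain of a dominance design of format `(m, K)`:
`n ≤ (K − 1) · (m + D)` with `D = Σₖ #{i : σₖ i ≠ σₖ₊₁ i}` the total number of (step, column) pairs at which the column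
changes its row.  Alternations are paid for by moved columns, `K − 1` alternations per unit of displacement, after a one-time
budget `m(K−1)`. [folklore] -/
theorem steps_le_pred_mul_add_displacement (d : Fin K → ℕ) (v ε : Fin m → Fin m → Fin K → ℤ) {n : ℕ}
    (θ : Fin (n + 1) → ℤ) (p : Fin (n + 1) → Equiv.Perm (Fin m) × (Fin m → Fin K)) (hθ : StrictMono θ)
    (hdom : ∀ k, IsDominant d v ε (θ k) (p k))
    (halt : ∀ k : Fin n, termSign ε (p k.castSucc) * termSign ε (p k.succ) < 0) :
    n ≤ (K - 1) * (m + ∑ k : Fin n, (univ.filter fun i : Fin m => (p k.castSucc).1 i ≠ (p k.succ).1 i).card) := by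
  -- (a) n ≤ Σ_k #{i : rise at (k,i)}
  have ha : n ≤ ∑ k : Fin n, (univ.filter fun i : Fin m =>
      dRank d ((p k.castSucc).2 i) < dRank d ((p k.succ).2 i)).card := by
    calc n = ∑ _k : Fin n, 1 := by simp
      _ ≤ _ := sum_le_sum fun k _ => card_pos.mpr (by
          obtain ⟨i, hi⟩ := exists_dRank_lt_step d v ε θ p hθ hdom halt k
          exact ⟨i, mem_filter.mpr ⟨mem_univ _, hi⟩⟩)
  -- (b) double counting: Σ_k #{i : P k i} = Σ_i #{k : P k i}
  have hswap : ∀ P : Fin n → Fin m → Prop, ∀ [∀ k i, Decidable (P k i)],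
      ∑ k : Fin n, (univ.filter fun i : Fin m => P k i).card = ∑ i : Fin m, (univ.filter fun k : Fin n => P k i).card := by
    intro P _
    simp only [card_eq_sum_ones, sum_filter]
    exact sum_comm
  rw [hswap] at ha
  rw [hswap (fun k i => (p k.castSucc).1 i ≠ (p k.succ).1 i)]
  -- (c) per column
  have hc := fun i => card_ups_col_le d v ε θ p hθ hdom i
  calc n ≤ ∑ i : Fin m, (univ.filter fun k : Fin n => dRank d ((p k.castSucc).2 i) < dRank d ((p k.succ).2 i)).card := ha
    _ ≤ ∑ i : Fin m, (K - 1) * ((univ.filter fun k : Fin n => (p k.castSucc).1 i ≠ (p k.succ).1 i).card + 1) :=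
        sum_le_sum fun i _ => hc i
    _ = (K - 1) * (m + ∑ i : Fin m, (univ.filter fun k : Fin n => (p k.castSucc).1 i ≠ (p k.succ).1 i).card) := by
        rw [← mul_sum, sum_add_distrib, sum_const, card_univ, Fintype.card_fin, smul_eq_mul, mul_one, add_comm]

/-- Row form: if along EVERY dominant sign-alternating chain of format `(m, K)` the displacement is at most `D`, then
`TropRootLawAt m K ((K−1)·(m + D))`. [folklore] -/
theorem tropRootLawAt_of_displacementBound (m K D : ℕ)
    (hD : ∀ (d : Fin K → ℕ) (v ε : Fin m → Fin m → Fin K → ℤ) (n : ℕ) (θ : Fin (n + 1) → ℤ)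
      (p : Fin (n + 1) → Equiv.Perm (Fin m) × (Fin m → Fin K)),
      (∀ i j l, (ε i j l).natAbs ≤ 1) → StrictMono θ → (∀ k, IsDominant d v ε (θ k) (p k)) →
      (∀ k : Fin n, termSign ε (p k.castSucc) * termSign ε (p k.succ) < 0) →
      ∑ k : Fin n, (univ.filter fun i : Fin m => (p k.castSucc).1 i ≠ (p k.succ).1 i).card ≤ D) :
    TropRootLawAt m K ((K - 1) * (m + D)) := by
  intro d v ε n θ p hε hθ hdom halt
  exact (steps_le_pred_mul_add_displacement d v ε θ p hθ hdom halt).trans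
    (Nat.mul_le_mul_left _ (Nat.add_le_add_left (hD d v ε n θ p hε hθ hdom halt) _))

end Displacement

end Summit.ValiantsHypothesis.ValiantsHypothesis.Theorems.LacunarySymmetroidMatrixDescartes.TropicalCensus
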